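import Summits.QuantumFields.QCD.Theorems.QuarksAsStableActionStableActionBridgeDefs
import Literature.MathematicalPhysics.QuantumLattice.GrassmannGaussianMoments
import HarnessLib

/-!
# Exact permutation symmetry (OS E3) of the lattice `n`-point distributions of lattice QCD

Stub `stub_permExact` of the line `Sketch` (reshape r3d) for the crux `QuarksAsStableAction.StableActionBridge`
(stmt-QuantumFields-9737): for every scheme, step `k`, arity `n`, species string `σ`, permutation `π` and test
function `F`,
  `qcdLatticeDist sch k n σ (permTest π F) = qcdLatticeDist sch k n (σ ∘ π) F`
EXACTLY at finite `k` (it replaces the asymptotic clause P7 of the lattice package).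

Proof.  The renormalised centred insertions `renormInsertion sch k s y U = (z a⁴ : ℂ) • (O_s(y) − shift)` are
CENTRAL Grassmann elements: the glue density and the shift are scalars (`Algebra.commute_algebraMap_left`), and the
meson species are `ℂ`-combinations of the quark bilinears `ψ̄_v ψ_w`, which are central
(`commute_psiBar_mul_psi`).  Hence the ORDERED product `∏ᵢ renormInsertion (σ i) (x i) U` over `List.ofFn` is
invariant under reindexing by `π` (`Equiv.Perm.ofFn_comp_perm` + `List.Perm.prod_eq'` for a pairwise commuting
list), so the weights satisfy `W_{σ∘π}(x ∘ π) = W_σ(x)` (`qcdTorusMomentStr_comp_perm`), and reindexing the finite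
sum `qcdLatticeDist_apply` over `(box L_k)ⁿ` by the bijection `x ↦ x ∘ π` gives the claim (`permTest_apply`); in
degree `0` both sides are point evaluation at the unique point.  Model: the commutative Yang–Mills analogue
`torusMomentStr_comp_perm` / `latticeDistStr_permTest`
(`YangMills/Theorems/LangevinControlUVOSLegsFromFemtoAndGapStubAssemblyStrings.lean`).
Everything is proved; no named fact.  References: Osterwalder–Schrader 1973 §2 (E3); Montvay–Münster 1994 §4.1, §5.1.
-/

noncomputable section

open scoped SchwartzMap BigOperators
open MeasureTheory
open Literature.MathematicalPhysics.QuantumFieldTheory Literature.MathematicalPhysics.QuantumLattice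
open Literature.MathematicalPhysics.AQFT
open Literature.Probability.LatticeModels (box Site TorusSite)

local notation "E4" => EuclideanSpace ℝ (Fin 4)

namespace Summit.QuantumFields.QCD.Cruxes.StableActionBridge.Sketch

/-! ### Ordered products of central elements are permutation invariant -/

/-- In any monoid, the ordered product over `List.ofFn` of a family of CENTRAL elements is invariant under
reindexing by a permutation (the reindexed list is a permutation of the original, and its members pairwise
commute). -/
theorem prod_ofFn_comp_perm_of_commute {M : Type*} [Monoid M] {n : ℕ} (g : Fin n → M)
    (hg : ∀ i z, Commute (g i) z) (π : Equiv.Perm (Fin n)) :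
    (List.ofFn (g ∘ π)).prod = (List.ofFn g).prod :=
  (Equiv.Perm.ofFn_comp_perm π g).prod_eq' (List.pairwise_ofFn.2 fun i j _ => hg (π i) (g (π j)))

/-! ### The insertions are central Grassmann elements -/

section Central

variable {Nf L : ℕ} [NeZero L]

/-- The local pseudoscalar bilinear `P_{fg}(x) = ∑ (iγ₅)_{αβ} ψ̄_{f,x,a,α} ψ_{g,x,a,β}` is central in the Grassmann
algebra (each pair `ψ̄_v ψ_w` is). -/
theorem commute_pseudoscalarBilinear (f g : Fin Nf) (x : TorusSite 4 L) (z : FermiAlg Nf L) :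
    Commute (pseudoscalarBilinear f g x) z := by
  unfold pseudoscalarBilinear
  refine Commute.sum_left _ _ _ fun a _ => Commute.sum_left _ _ _ fun α _ =>
    Commute.sum_left _ _ _ fun β _ => Commute.smul_left ?_ _
  exact commute_psiBar_mul_psi ℂ _ _ z

/-- The lattice insertion of every species at every site is central in the Grassmann algebra: the glue density
is a scalar, the meson species are `ℂ`-combinations of central quark bilinears. -/
theorem commute_insertion (U : GaugeConfig 4 L (Matrix.specialUnitaryGroup (Fin 3) ℂ)) (s : QCDField Nf)
    (y : Site 4) (z : FermiAlg Nf L) : Commute (insertion U s y) z := by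
  cases s with
  | glue =>
    simp only [insertion]
    exact Algebra.commute_algebraMap_left _ _
  | pseudoRe f g =>
    simp only [insertion]
    exact ((commute_pseudoscalarBilinear f g _ z).add_left (commute_pseudoscalarBilinear g f _ z)).smul_left _
  | pseudoIm f g =>
    simp only [insertion]
    exact ((commute_pseudoscalarBilinear f g _ z).sub_left (commute_pseudoscalarBilinear g f _ z)).smul_left _

end Central

variable {Nf : ℕ}

/-- The renormalised centred insertion `z_s(k) a_k⁴ (O_s(y) − shift_s(k))` is central in the Grassmann algebra. -/
theorem commute_renormInsertion (sch : QCDScheme Nf) (k : ℕ) (s : QCDField Nf) (y : Site 4)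
    (U : GaugeConfig 4 (sch.side k) (Matrix.specialUnitaryGroup (Fin 3) ℂ)) (z : FermiAlg Nf (sch.side k)) :
    Commute (renormInsertion sch k s y U) z := by
  unfold renormInsertion
  exact ((commute_insertion U s y z).sub_left (Algebra.commute_algebraMap_left _ _)).smul_left _

/-! ### Permutation symmetry of the weights and of the distribution -/

-- adapted from `torusMomentStr_comp_perm` / `latticeDistStr_permTest` in
-- `Summits/QuantumFields/YangMills/Theorems/LangevinControlUVOSLegsFromFemtoAndGapStubAssemblyStrings.lean`
-- (commutative weights there; here the ordered Grassmann product is reindexed through centrality).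

/-- **Permutation symmetry of the weights**: permuting the species string and the sites simultaneously does not
change the torus moment, `W_{σ∘π}(x ∘ π) = W_σ(x)` — the ordered product of the (central) renormalised insertions
is reindexed by `π`. -/
theorem qcdTorusMomentStr_comp_perm (sch : QCDScheme Nf) (k : ℕ) {n : ℕ} (σ : Fin n → QCDField Nf)
    (x : Fin n → Site 4) (π : Equiv.Perm (Fin n)) :
    qcdTorusMomentStr sch k (σ ∘ π) (x ∘ π) = qcdTorusMomentStr sch k σ x := by
  unfold qcdTorusMomentStr
  congr 1
  refine integral_congr_ae (Filter.Eventually.of_forall fun U => ?_)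
  have h : (List.ofFn fun i => renormInsertion sch k ((σ ∘ π) i) ((x ∘ π) i) U).prod =
      (List.ofFn fun i => renormInsertion sch k (σ i) (x i) U).prod :=
    prod_ofFn_comp_perm_of_commute (fun i => renormInsertion sch k (σ i) (x i) U)
      (fun i z => commute_renormInsertion sch k (σ i) (x i) U z) π
  simp only [h]

/-- **Stub `stub_permExact` (OS E3 on the lattice, exactly).**  For every scheme, step `k`, arity `n`, species
string `σ`, permutation `π` and test function `F`:
`qcdLatticeDist sch k n σ (permTest π F) = qcdLatticeDist sch k n (σ ∘ π) F` — the species string travels with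
its argument, as in `LabelledSchwingerFamily.IsSymmetric`.  Degree `0`: both sides are evaluation at the unique
point; degree `n ≥ 1`: reindex the finite sum `qcdLatticeDist_apply` by `x ↦ x ∘ π` and use
`qcdTorusMomentStr_comp_perm`, `permTest_apply`. -/
theorem stub_permExact : ∀ {Nf : ℕ} (sch : QCDScheme Nf) (k n : ℕ) (σ : Fin n → QCDField Nf)
    (π : Equiv.Perm (Fin n)) (F : 𝓢((Fin n → E4), ℂ)),
    qcdLatticeDist sch k n σ (permTest π F) = qcdLatticeDist sch k n (σ ∘ π) F := by
  intro Nf sch k n σ π F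
  rcases Nat.eq_zero_or_pos n with rfl | hn
  · rw [qcdLatticeDist_zero_apply, qcdLatticeDist_zero_apply, permTest_apply]
    exact congrArg F (Subsingleton.elim _ _)
  · rw [qcdLatticeDist_apply sch k hn.ne', qcdLatticeDist_apply sch k hn.ne']
    -- reindex the sum over multi-sites by `x ↦ x ∘ π`
    refine Finset.sum_bij' (fun x _ => x ∘ π) (fun x _ => x ∘ π.symm) (fun x hx => ?_)
      (fun x hx => ?_) (fun x _ => ?_) (fun x _ => ?_) (fun x _ => ?_)
    · simp only [Fintype.mem_piFinset, Function.comp_apply] at hx ⊢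
      exact fun i => hx _
    · simp only [Fintype.mem_piFinset, Function.comp_apply] at hx ⊢
      exact fun i => hx _
    · funext i; simp
    · funext i; simp
    · rw [qcdTorusMomentStr_comp_perm, permTest_apply]
      rfl

end Summit.QuantumFields.QCD.Cruxes.StableActionBridge.Sketch

end
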